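import Summits.BirchSwinnertonDyer.BirchSwinnertonDyer.Theorems.ManinLocalTwoThreeSL2OddPrimeSquareRoots
import Mathlib.GroupTheory.Sylow
import Mathlib.GroupTheory.SpecificGroups.Cyclic
import Mathlib.FieldTheory.IsAlgClosed.AlgebraicClosure
import Mathlib.RingTheory.IntegralDomain
import HarnessLib

set_option autoImplicit false
set_option linter.dupNamespace false

/-!
# `SL₂(𝔽_q)`, `q` an odd prime: the normaliser of a cyclic subgroup of order `4` has odd index

Summit `BirchSwinnertonDyer`, route `ManinLocalTwoThree` (cell bsd-f2-manin), crux C2 `ManinOddAtFour`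
(stmt-BirchSwinnertonDyer-22967), line `kato_shift_two` v7, stub `stub_sl2OddPrimeExtensionFact` (= Literature fact
F-es-27′ `sl2ZModOddPrime_existsUnique_extension_of_stable_character`).  MODULE A/2 of its elementary proof
(companion of `ManinLocalTwoThreeSL2OddPrimeSquareRoots.lean`).  For `s ∈ SL₂(𝔽_q)` with `s² = -1`: `orderOf_eq_four`;
`mem_normalizer_zpowers_iff` (`g` normalises `⟨s⟩` iff `g s g⁻¹ ∈ {s, s⁻¹}`); `not_two_dvd_index_normalizer_zpowers` —
**`N(⟨s⟩)` has ODD index** (a Sylow `2`-subgroup `P` contains `-1`; a central involution of `P/⟨-1⟩` lifts to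
`y ∈ P` with `y² = -1`, `⟨y⟩ ⊴ P`, so `P ≤ N(⟨y⟩)`, conjugate to `N(⟨s⟩)` since all square roots of `-1` are
conjugate).  For the model `w = (0 -1; 1 0)`: its centraliser is `{(p -r; r p)}`, CYCLIC (it embeds in an
algebraically closed field via `p + r·i`), of order divisible by `4`; any `j` with `j w j⁻¹ = w⁻¹` has `j² = -1` and
inverts the whole torus.  No definitions; nothing about BSD or the Manin constant is asserted here.  Standard material
(Dickson, *Linear Groups*, Ch. XII; Huppert, *Endliche Gruppen I*, II §8).
-/

open scoped MatrixGroups Pointwise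

namespace Summit.BirchSwinnertonDyer.BirchSwinnertonDyer.Theorems.ManinLocalTwoThree

namespace SL2ZModOddPrime

variable {q : ℕ} [Fact q.Prime]

omit [Fact q.Prime] in
/-- `s² = -1 ⇒ s⁻¹ = -s` (plumbing). [folklore] -/
theorem inv_eq_neg {s : SL(2, ZMod q)} (hs : s * s = -1) : s⁻¹ = -s := by
  rw [inv_eq_iff_mul_eq_one, mul_neg, hs, neg_neg]

/-- `s² = -1 ⇒ s` has order `4` (`q` odd). [folklore] -/
theorem orderOf_eq_four (hq : q ≠ 2) {s : SL(2, ZMod q)} (hs : s * s = -1) : orderOf s = 4 := by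
  haveI : Fact (Nat.Prime 2) := ⟨Nat.prime_two⟩
  have h2 : s ^ 2 = -1 := by rw [pow_two, hs]
  have h : orderOf s = 2 ^ (1 + 1) := by
    apply orderOf_eq_prime_pow
    · rw [pow_one, h2]; exact neg_one_ne_one hq
    · rw [show 2 ^ (1 + 1) = 2 * 2 from rfl, pow_mul, h2]; simp
  simpa using h

/-- **Normaliser of `⟨s⟩`, `s² = -1`**: `g` normalises `⟨s⟩` iff `g s g⁻¹ = s` or `g s g⁻¹ = s⁻¹`. [folklore] -/
theorem mem_normalizer_zpowers_iff (hq : q ≠ 2) {s : SL(2, ZMod q)} (hs : s * s = -1) (g : SL(2, ZMod q)) :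
    g ∈ Subgroup.normalizer (Subgroup.zpowers s : Set (SL(2, ZMod q))) ↔
      g * s * g⁻¹ = s ∨ g * s * g⁻¹ = s⁻¹ := by
  classical
  constructor
  · intro hg
    have hmem : g * s * g⁻¹ ∈ Subgroup.zpowers s :=
      (Subgroup.mem_normalizer_iff.1 hg s).1 (Subgroup.mem_zpowers s)
    rw [mem_zpowers_iff_mem_range_orderOf, Finset.mem_image] at hmem
    obtain ⟨n, hn, hns⟩ := hmem
    rw [Finset.mem_range, orderOf_eq_four hq hs] at hn
    interval_cases n
    · exfalso
      rw [pow_zero] at hns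
      have : s = 1 := by
        have := hns.symm
        rwa [mul_inv_eq_one, mul_eq_left] at this
      rw [this, mul_one] at hs
      exact neg_one_ne_one hq hs.symm
    · left; rw [← hns, pow_one]
    · exfalso
      rw [pow_two, hs] at hns
      have : s = -1 := by
        have h1 := hns.symm
        rw [mul_inv_eq_iff_eq_mul] at h1
        -- `g s = -1 * g = -g`
        have : g * s = g * (-1) := by rw [h1]; simp
        exact mul_left_cancel this
      rw [this] at hs
      apply neg_one_ne_one hq
      simpa using hs.symm
    · right
      rw [← hns, pow_succ, pow_two, hs, inv_eq_neg hs]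
      simp
  · intro hg
    -- in either case, conjugation by `g` and by `g⁻¹` maps `s` to `s ^ ε`
    have hfwd : ∃ ε : ℤ, g * s * g⁻¹ = s ^ ε := by
      rcases hg with h | h
      · exact ⟨1, by rw [h, zpow_one]⟩
      · exact ⟨-1, by rw [h, zpow_neg_one]⟩
    have hbwd : ∃ ε : ℤ, g⁻¹ * s * g = s ^ ε := by
      rcases hg with h | h
      · refine ⟨1, ?_⟩
        rw [zpow_one]
        calc g⁻¹ * s * g = g⁻¹ * (g * s * g⁻¹) * g := by rw [h]
          _ = s := by group
      · refine ⟨-1, ?_⟩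
        have h' : g * s⁻¹ * g⁻¹ = s := by
          have := congrArg (·⁻¹) h
          simpa only [mul_inv_rev, inv_inv, mul_assoc] using this
        rw [zpow_neg_one]
        calc g⁻¹ * s * g = g⁻¹ * (g * s⁻¹ * g⁻¹) * g := by rw [h']
          _ = s⁻¹ := by group
    obtain ⟨ε, hε⟩ := hfwd
    obtain ⟨δ, hδ⟩ := hbwd
    rw [Subgroup.mem_normalizer_iff]
    intro h
    constructor
    · intro hh
      obtain ⟨k, rfl⟩ := Subgroup.mem_zpowers_iff.1 hh
      rw [← conj_zpow, hε, ← zpow_mul]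
      exact Subgroup.zpow_mem_zpowers _ _
    · intro hh
      obtain ⟨k, hk⟩ := Subgroup.mem_zpowers_iff.1 hh
      have : h = g⁻¹ * s ^ k * g := by rw [hk]; group
      rw [this, show g⁻¹ * s ^ k * g = (g⁻¹ * s * g⁻¹⁻¹) ^ k by rw [conj_zpow, inv_inv], inv_inv, hδ, ← zpow_mul]
      exact Subgroup.zpow_mem_zpowers _ _

/-- `-1` lies in every subgroup of `SL₂(𝔽_q)` (`q` odd) of even order — in particular in every Sylow `2`-subgroup
once some element of order `4` exists (plumbing for the odd-index theorem). [folklore] -/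
theorem neg_one_mem_of_two_dvd_card (hq : q ≠ 2) (P : Subgroup (SL(2, ZMod q))) (h2 : 2 ∣ Nat.card P) :
    (-1 : SL(2, ZMod q)) ∈ P := by
  haveI : Fact (Nat.Prime 2) := ⟨Nat.prime_two⟩
  obtain ⟨z, hz⟩ := exists_prime_orderOf_dvd_card' (G := P) 2 h2
  have hz' : z ^ 2 = 1 := by have := pow_orderOf_eq_one z; rwa [hz] at this
  have hz2 : (z : SL(2, ZMod q)) * z = 1 := by
    rw [← Subgroup.coe_mul, ← pow_two, hz', Subgroup.coe_one]
  rcases eq_one_or_eq_neg_one_of_mul_self_eq_one hq _ hz2 with h | h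
  · exfalso
    have : z = 1 := Subtype.ext h
    rw [this, orderOf_one] at hz
    exact absurd hz (by norm_num)
  · rw [← h]; exact z.2

/-- **The normaliser of a cyclic subgroup of order `4` in `SL₂(𝔽_q)` (`q` odd) has odd index** (it contains a
Sylow `2`-subgroup).  [folklore] -/
theorem not_two_dvd_index_normalizer_zpowers (hq : q ≠ 2) {s : SL(2, ZMod q)} (hs : s * s = -1) :
    ¬ 2 ∣ (Subgroup.normalizer (Subgroup.zpowers s : Set (SL(2, ZMod q)))).index := by
  classical
  haveI : Fact (Nat.Prime 2) := ⟨Nat.prime_two⟩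
  obtain ⟨P⟩ : Nonempty (Sylow 2 (SL(2, ZMod q))) := inferInstance
  -- `4 ∣ |P|`, so `-1 ∈ P`
  have h4G : 2 ^ 2 ∣ Nat.card (SL(2, ZMod q)) := by
    have := orderOf_dvd_natCard s; rwa [orderOf_eq_four hq hs] at this
  have h4P : 2 ^ 2 ∣ Nat.card (P : Subgroup (SL(2, ZMod q))) := P.pow_dvd_card_of_pow_dvd_card h4G
  have h2P : 2 ∣ Nat.card (P : Subgroup (SL(2, ZMod q))) := dvd_trans ⟨2, by norm_num⟩ h4P
  have hneg : (-1 : SL(2, ZMod q)) ∈ (P : Subgroup (SL(2, ZMod q))) := neg_one_mem_of_two_dvd_card hq _ h2P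
  -- the central subgroup `Z = ⟨-1⟩` of `P`
  let z : (P : Subgroup (SL(2, ZMod q))) := ⟨-1, hneg⟩
  have hzc : ∀ p : (P : Subgroup (SL(2, ZMod q))), p * z = z * p := fun p => by
    apply Subtype.ext; simp [z]
  have hz2 : orderOf z = 2 := by
    rw [← Subgroup.orderOf_coe]
    refine orderOf_eq_prime ?_ ?_
    · simp [z]
    · simpa [z] using neg_one_ne_one hq
  let Z : Subgroup (P : Subgroup (SL(2, ZMod q))) := Subgroup.zpowers z
  haveI hZn : Z.Normal := by
    refine ⟨fun n hn g => ?_⟩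
    obtain ⟨k, rfl⟩ := Subgroup.mem_zpowers_iff.1 hn
    have : g * z ^ k * g⁻¹ = z ^ k := by
      rw [← conj_zpow]
      congr 1
      rw [mul_inv_eq_iff_eq_mul, hzc]
    rw [this]; exact Subgroup.zpow_mem_zpowers _ _
  have hZcard : Nat.card Z = 2 := by rw [Nat.card_zpowers, hz2]
  -- the quotient `P / Z` is a non-trivial `2`-group; pick a central involution `ȳ`
  have hPq : IsPGroup 2 ((P : Subgroup (SL(2, ZMod q))) ⧸ Z) := P.isPGroup'.to_quotient Z
  haveI : Nontrivial ((P : Subgroup (SL(2, ZMod q))) ⧸ Z) := by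
    rw [← Finite.one_lt_card_iff_nontrivial]
    have hcard := Subgroup.card_eq_card_quotient_mul_card_subgroup Z
    rw [hZcard] at hcard
    have hpos : 0 < Nat.card ((P : Subgroup (SL(2, ZMod q))) ⧸ Z) := Nat.card_pos
    rcases Nat.lt_or_ge 1 (Nat.card ((P : Subgroup (SL(2, ZMod q))) ⧸ Z)) with h | h
    · exact h
    · exfalso
      have h1 : Nat.card ((P : Subgroup (SL(2, ZMod q))) ⧸ Z) = 1 := le_antisymm h hpos
      rw [h1, one_mul] at hcard
      rw [hcard] at h4P
      norm_num at h4P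
  haveI : Nontrivial (Subgroup.center ((P : Subgroup (SL(2, ZMod q))) ⧸ Z)) := hPq.center_nontrivial
  have h2c : 2 ∣ Nat.card (Subgroup.center ((P : Subgroup (SL(2, ZMod q))) ⧸ Z)) := by
    rcases (hPq.to_subgroup (Subgroup.center _)).card_eq_or_dvd with h | h
    · exfalso
      exact (Finite.one_lt_card_iff_nontrivial.2 inferInstance).ne' h
    · exact h
  obtain ⟨yc, hyc⟩ := exists_prime_orderOf_dvd_card' (G := Subgroup.center ((P : Subgroup (SL(2, ZMod q))) ⧸ Z)) 2 h2c
  -- `ȳ := yc`, central of order 2; lift to `y ∈ P`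
  obtain ⟨y, hy⟩ := QuotientGroup.mk_surjective (yc : (P : Subgroup (SL(2, ZMod q))) ⧸ Z)
  have hyc1 : (yc : (P : Subgroup (SL(2, ZMod q))) ⧸ Z) ≠ 1 := by
    intro h
    have : yc = 1 := Subtype.ext h
    rw [this, orderOf_one] at hyc
    exact absurd hyc (by norm_num)
  have hyc2 : (yc : (P : Subgroup (SL(2, ZMod q))) ⧸ Z) ^ 2 = 1 := by
    have := pow_orderOf_eq_one yc; rw [hyc] at this; rw [← Subgroup.coe_pow, this, Subgroup.coe_one]
  have hycc : ∀ x : (P : Subgroup (SL(2, ZMod q))) ⧸ Z, x * yc = yc * x := fun x =>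
    (Subgroup.mem_center_iff.1 yc.2 x)
  -- membership in `Z = {1, z}`
  have hZmem : ∀ x : (P : Subgroup (SL(2, ZMod q))), x ∈ Z → x = 1 ∨ x = z := by
    intro x hx
    rw [mem_zpowers_iff_mem_range_orderOf, Finset.mem_image] at hx
    obtain ⟨n, hn, rfl⟩ := hx
    rw [Finset.mem_range, hz2] at hn
    interval_cases n <;> simp
  -- `y² = -1`
  have hy2 : (y : SL(2, ZMod q)) * y = -1 := by
    have hmem : y * y ∈ Z := by
      rw [← QuotientGroup.eq_one_iff, QuotientGroup.mk_mul, hy, ← pow_two, hyc2]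
    rcases hZmem _ hmem with h | h
    · exfalso
      have h' : (y : SL(2, ZMod q)) * y = 1 := by rw [← Subgroup.coe_mul, h, Subgroup.coe_one]
      rcases eq_one_or_eq_neg_one_of_mul_self_eq_one hq _ h' with h1 | h1
      · apply hyc1
        rw [← hy, QuotientGroup.eq_one_iff]
        have : y = 1 := Subtype.ext h1
        rw [this]; exact Z.one_mem
      · apply hyc1
        rw [← hy, QuotientGroup.eq_one_iff]
        have : y = z := Subtype.ext h1
        rw [this]; exact Subgroup.mem_zpowers z
    · have := congrArg (fun t : (P : Subgroup (SL(2, ZMod q))) => (t : SL(2, ZMod q))) h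
      simpa [z] using this
  -- `P ≤ N(⟨y⟩)`
  have hPle : (P : Subgroup (SL(2, ZMod q))) ≤
      Subgroup.normalizer (Subgroup.zpowers (y : SL(2, ZMod q)) : Set (SL(2, ZMod q))) := by
    intro p hp
    rw [mem_normalizer_zpowers_iff hq hy2]
    let p' : (P : Subgroup (SL(2, ZMod q))) := ⟨p, hp⟩
    have hmem : (p' * y * p'⁻¹)⁻¹ * y ∈ Z := by
      rw [← QuotientGroup.eq, QuotientGroup.mk_mul, QuotientGroup.mk_mul, QuotientGroup.mk_inv, hy,
        hycc, mul_inv_cancel_right]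
    rcases hZmem _ hmem with h | h
    · left
      have : p' * y * p'⁻¹ = y := by
        rw [inv_mul_eq_one] at h; exact h
      have := congrArg (fun t : (P : Subgroup (SL(2, ZMod q))) => (t : SL(2, ZMod q))) this
      simpa [p'] using this
    · right
      have h' : p' * y * p'⁻¹ = y * z⁻¹ := by
        rw [inv_mul_eq_iff_eq_mul] at h
        rw [eq_mul_inv_iff_mul_eq, ← h]
      have := congrArg (fun t : (P : Subgroup (SL(2, ZMod q))) => (t : SL(2, ZMod q))) h'
      simp only [p', Subgroup.coe_mul, Subgroup.coe_inv, z] at this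
      rw [this, inv_eq_neg hy2]
      simp
  -- conjugate `y` to `s`
  obtain ⟨g, hg⟩ := exists_conj_eq_of_mul_self_eq_neg_one hq (y : SL(2, ZMod q)) s hy2 hs
  have hmap : Subgroup.normalizer (Subgroup.zpowers s : Set (SL(2, ZMod q))) =
      Subgroup.map (MulAut.conj g).toMonoidHom
        (Subgroup.normalizer (Subgroup.zpowers (y : SL(2, ZMod q)) : Set (SL(2, ZMod q)))) := by
    rw [Subgroup.map_equiv_normalizer_eq, MonoidHom.map_zpowers]
    congr 2
    simp [hg]
  have hidx : (Subgroup.normalizer (Subgroup.zpowers s : Set (SL(2, ZMod q)))).index =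
      (Subgroup.normalizer (Subgroup.zpowers (y : SL(2, ZMod q)) : Set (SL(2, ZMod q)))).index := by
    rw [hmap, MulEquiv.toMonoidHom_eq_coe, Subgroup.index_map_equiv]
  rw [hidx]
  intro h2
  have hdvd : (Subgroup.normalizer (Subgroup.zpowers (y : SL(2, ZMod q)) : Set (SL(2, ZMod q)))).index ∣
      (P : Subgroup (SL(2, ZMod q))).index :=
    Subgroup.index_dvd_of_le hPle
  exact P.not_dvd_index (dvd_trans h2 hdvd)

/-! ### The model square root `w = (0 -1; 1 0)` and its centraliser torus -/

/-- `w² = -1` for `w = (0 -1; 1 0)`. [folklore] -/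
theorem mul_self_w {w : SL(2, ZMod q)} (hw : (w : Matrix (Fin 2) (Fin 2) (ZMod q)) = !![0, -1; 1, 0]) :
    w * w = -1 := by
  ext i j
  fin_cases i <;> fin_cases j <;> simp [Matrix.mul_apply, Fin.sum_univ_two, hw]

/-- **The centraliser of `w = (0 -1; 1 0)` in `SL₂(𝔽_q)`** is `{(p -r; r p)}`. [folklore] -/
theorem mem_centralizer_w_iff {w : SL(2, ZMod q)} (hw : (w : Matrix (Fin 2) (Fin 2) (ZMod q)) = !![0, -1; 1, 0])
    (g : SL(2, ZMod q)) :
    g ∈ Subgroup.centralizer ({w} : Set (SL(2, ZMod q))) ↔ g 0 1 = -g 1 0 ∧ g 1 1 = g 0 0 := by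
  rw [Subgroup.mem_centralizer_singleton_iff]
  constructor
  · intro h
    have h00 := congrArg (fun m : SL(2, ZMod q) => m 0 0) h
    have h10 := congrArg (fun m : SL(2, ZMod q) => m 1 0) h
    simp only [mul_apply_two, hw] at h00 h10
    simp at h00 h10
    exact ⟨by linear_combination h00, by linear_combination h10⟩
  · rintro ⟨h1, h2⟩
    ext i j
    fin_cases i <;> fin_cases j <;> simp [mul_apply_two, hw, h1, h2]

/-- **The centraliser torus of `w` is cyclic**: it embeds into the multiplicative group of an algebraically closed
field via `(p -r; r p) ↦ p + r·i`, `i² = -1`. [folklore] -/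
theorem isCyclic_centralizer_w (hq : q ≠ 2) {w : SL(2, ZMod q)}
    (hw : (w : Matrix (Fin 2) (Fin 2) (ZMod q)) = !![0, -1; 1, 0]) :
    IsCyclic (Subgroup.centralizer ({w} : Set (SL(2, ZMod q)))) := by
  classical
  let F := AlgebraicClosure (ZMod q)
  obtain ⟨i, hi⟩ := IsAlgClosed.exists_pow_nat_eq (-1 : F) (n := 2) (by norm_num)
  let ι := algebraMap (ZMod q) F
  have hrel : ∀ g : Subgroup.centralizer ({w} : Set (SL(2, ZMod q))),
      (g : SL(2, ZMod q)) 0 1 = -(g : SL(2, ZMod q)) 1 0 ∧ (g : SL(2, ZMod q)) 1 1 = (g : SL(2, ZMod q)) 0 0 :=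
    fun g => (mem_centralizer_w_iff hw _).1 g.2
  let f : Subgroup.centralizer ({w} : Set (SL(2, ZMod q))) →* F :=
    { toFun := fun g => ι ((g : SL(2, ZMod q)) 0 0) + ι ((g : SL(2, ZMod q)) 1 0) * i
      map_one' := by simp [ι]
      map_mul' := fun g h => by
        obtain ⟨hg1, hg2⟩ := hrel g
        simp only [Subgroup.coe_mul, mul_apply_two, hg1, hg2, map_add, map_mul, map_neg, ι]
        linear_combination (-(algebraMap (ZMod q) F ((g : SL(2, ZMod q)) 1 0) *
          algebraMap (ZMod q) F ((h : SL(2, ZMod q)) 1 0))) * hi }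
  refine isCyclic_of_injective_ringHom f ((injective_iff_map_eq_one f).2 fun g hg => ?_)
  obtain ⟨hg1, hg2⟩ := hrel g
  have hdet := det_two (g : SL(2, ZMod q))
  rw [hg1, hg2] at hdet
  -- `a + c i = 1` and `a² + c² = 1`
  have h1 : ι ((g : SL(2, ZMod q)) 0 0) + ι ((g : SL(2, ZMod q)) 1 0) * i = 1 := hg
  have h2 : ι ((g : SL(2, ZMod q)) 0 0) ^ 2 + ι ((g : SL(2, ZMod q)) 1 0) ^ 2 = 1 := by
    have := congrArg ι hdet
    simp only [map_sub, map_mul, map_neg, map_one, ι] at this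
    linear_combination this
  have h3 : ι ((g : SL(2, ZMod q)) 0 0) - ι ((g : SL(2, ZMod q)) 1 0) * i = 1 := by
    linear_combination (-(ι ((g : SL(2, ZMod q)) 0 0) - ι ((g : SL(2, ZMod q)) 1 0) * i)) * h1 + h2
      - (ι ((g : SL(2, ZMod q)) 1 0)) ^ 2 * hi
  have h2F : (2 : F) ≠ 0 := by
    haveI : CharP F q := inferInstance
    intro h
    have : ((2 : ℕ) : F) = 0 := by exact_mod_cast h
    rw [CharP.cast_eq_zero_iff F q] at this
    have hle : q ≤ 2 := Nat.le_of_dvd (by norm_num) this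
    exact hq (le_antisymm hle (Fact.out : q.Prime).two_le)
  have hi0 : i ≠ 0 := by
    intro h0; rw [h0] at hi; norm_num at hi
  have hc : ι ((g : SL(2, ZMod q)) 1 0) = 0 := by
    have : (2 * i) * ι ((g : SL(2, ZMod q)) 1 0) = 0 := by linear_combination h1 - h3
    rcases mul_eq_zero.1 this with h | h
    · exact absurd h (mul_ne_zero h2F hi0)
    · exact h
  have ha : ι ((g : SL(2, ZMod q)) 0 0) = 1 := by rw [hc] at h1; simpa using h1
  have hc' : (g : SL(2, ZMod q)) 1 0 = 0 := by
    apply (algebraMap (ZMod q) F).injective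
    simpa [ι] using hc
  have ha' : (g : SL(2, ZMod q)) 0 0 = 1 := by
    apply (algebraMap (ZMod q) F).injective
    simpa [ι] using ha
  apply Subtype.ext
  ext i' j'
  fin_cases i' <;> fin_cases j' <;> simp [hg1, hg2, ha', hc']

/-- `4` divides the order of the centraliser of an element `s` with `s² = -1` (`s` itself has order `4`).
[folklore] -/
theorem four_dvd_card_centralizer (hq : q ≠ 2) {s : SL(2, ZMod q)} (hs : s * s = -1) :
    4 ∣ Nat.card (Subgroup.centralizer ({s} : Set (SL(2, ZMod q)))) := by
  have hmem : s ∈ Subgroup.centralizer ({s} : Set (SL(2, ZMod q))) :=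
    Subgroup.mem_centralizer_singleton_iff.2 rfl
  have := orderOf_dvd_natCard (⟨s, hmem⟩ : Subgroup.centralizer ({s} : Set (SL(2, ZMod q))))
  rwa [← Subgroup.orderOf_coe, orderOf_eq_four hq hs] at this

/-- **Shape of an element inverting `w`**: `j w j⁻¹ = w⁻¹` forces `j = (a b; b -a)`. [folklore] -/
theorem entries_of_conj_w_eq_inv {w : SL(2, ZMod q)} (hw : (w : Matrix (Fin 2) (Fin 2) (ZMod q)) = !![0, -1; 1, 0])
    (j : SL(2, ZMod q)) (hj : j * w * j⁻¹ = w⁻¹) : j 1 1 = -j 0 0 ∧ j 0 1 = j 1 0 := by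
  rw [inv_eq_neg (mul_self_w hw), mul_inv_eq_iff_eq_mul] at hj
  have h00 := congrArg (fun m : SL(2, ZMod q) => m 0 0) hj
  have h01 := congrArg (fun m : SL(2, ZMod q) => m 0 1) hj
  simp only [mul_apply_two, hw] at h00 h01
  simp [Matrix.SpecialLinearGroup.coe_neg, hw] at h00 h01
  exact ⟨by linear_combination -h01, by linear_combination h00⟩

/-- **An element inverting `w` squares to `-1`.** [folklore] -/
theorem mul_self_eq_neg_one_of_conj_w_eq_inv {w : SL(2, ZMod q)}
    (hw : (w : Matrix (Fin 2) (Fin 2) (ZMod q)) = !![0, -1; 1, 0]) (j : SL(2, ZMod q)) (hj : j * w * j⁻¹ = w⁻¹) :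
    j * j = -1 := by
  obtain ⟨h1, h2⟩ := entries_of_conj_w_eq_inv hw j hj
  have hdet := det_two j
  rw [h1, h2] at hdet
  have e00 : (j * j) 0 0 = -1 := by rw [mul_apply_two, h2]; linear_combination -hdet
  have e01 : (j * j) 0 1 = 0 := by rw [mul_apply_two, h2, h1]; ring
  have e10 : (j * j) 1 0 = 0 := by rw [mul_apply_two, h1]; ring
  have e11 : (j * j) 1 1 = -1 := by rw [mul_apply_two, h1, h2]; linear_combination -hdet
  ext i j'
  fin_cases i <;> fin_cases j'
  · simpa [Matrix.SpecialLinearGroup.coe_neg] using e00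
  · simpa [Matrix.SpecialLinearGroup.coe_neg] using e01
  · simpa [Matrix.SpecialLinearGroup.coe_neg] using e10
  · simpa [Matrix.SpecialLinearGroup.coe_neg] using e11

/-- **An element inverting `w` inverts the whole centraliser torus of `w`** (`j (p -r; r p) j⁻¹ = (p r; -r p)`).
[folklore] -/
theorem conj_eq_inv_of_mem_centralizer_w {w : SL(2, ZMod q)}
    (hw : (w : Matrix (Fin 2) (Fin 2) (ZMod q)) = !![0, -1; 1, 0]) (j : SL(2, ZMod q)) (hj : j * w * j⁻¹ = w⁻¹)
    (c : SL(2, ZMod q)) (hc : c ∈ Subgroup.centralizer ({w} : Set (SL(2, ZMod q)))) : j * c * j⁻¹ = c⁻¹ := by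
  obtain ⟨h1, h2⟩ := entries_of_conj_w_eq_inv hw j hj
  obtain ⟨hc1, hc2⟩ := (mem_centralizer_w_iff hw c).1 hc
  rw [mul_inv_eq_iff_eq_mul]
  ext i j'
  fin_cases i <;> fin_cases j' <;>
    simp [mul_apply_two, Matrix.SpecialLinearGroup.coe_inv, Matrix.adjugate_fin_two, h1, h2, hc1, hc2] <;> ring

end SL2ZModOddPrime

end Summit.BirchSwinnertonDyer.BirchSwinnertonDyer.Theorems.ManinLocalTwoThree
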